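import Summits.ValiantsHypothesis.ValiantsHypothesis.Theorems.LacunarySymmetroidMatrixDescartesCensusTwistedRolle
import Summits.ValiantsHypothesis.ValiantsHypothesis.Theorems.SymmetroidPencilBasics

/-!
# `MatrixDescartes` census — DOOR A at `(3,4)`: the SQUARE LAW on the hollow-cross sector (a proved Descartes deficiency
# with its exact range of validity) and its SHARP FAILURE when the letters' exponents are close

HONEST FRAMING.  Object-search cell `pub-symmetroid`, door-A seat `val-sym-door-p3` (g22); helper beside the OPEN item
stmt-ValiantsHypothesis-19980 `DoorA34 = PosRootLawAt 3 4 18` (asserted nowhere).  Nothing in this file bounds `ζ_sym(3,4)`; nothing bears on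
`MatrixDescartes` (stmt-ValiantsHypothesis-18050) or on `VP ≠ VNP`.

WHAT IS HERE (all exponents, elementary).  The HOLLOW-CROSS pencils `[[a, 0, q], [0, b, p], [q, p, 0]]` form the ISOTROPIC sector of the symmetric
`3 × 3` format (`…CensusDoorA34HollowCornerChart.det_hollowCorner` at `ε = (0,0)`; the «isotropic family» of `…CensusDoorA34NodeCentres`): their
determinant is `−(a·p² + b·q²)` (`det_hollowCross`), a signed SUM OF TWO SQUARES with letter coefficients; the Hermitian analogue carries a product
`p·p'` in place of each square (`det_hollowCross'`).  The simplest square object of the sector is `L² + M` with `L, M` in the span of ONE three-letter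
alphabet `1, X^α, X^β` (the `(3,3)` hollow-cross pencil `[[−1,0,1],[0,−M,L],[1,L,0]]`, `det_unitHollowCross`): `6` monomials, Descartes bound `5`.

* **`card_posRoots_sq_add_le_four` (SQUARE LAW).**  If `β ≥ 2α` then `L² + M` has AT MOST FOUR distinct positive roots — one below Descartes.
  Proof = twisted Rolle in the Chebyshev space of the alphabet (`Census.card_posRoots_le_card_posRoots_twists`, killing the exponents `0, α, β`
  costs three roots) followed by the SIGN of the twisted top form `X^{2α}·(A + B·Xⁿ + C·X^{2n})` (`n = β − α`): `A = 2α²(2α − β)·u² ≤ 0 ≤ C`, and such a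
  form has at most one positive root (`card_posRoots_le_one_of_nonpos_nonneg`).
* **`five_le_card_posRoots_squareWitness` (SHARP FAILURE for `α < β < 2α`).**  On the alphabet `(0,2,3)` the member
  `(2000X² − 653X³)² + (−5232 + 418400X² − 2174000X³)` has FIVE distinct positive roots (sign alternation at `1/5, 27/100, 9/25, 1/2, 2, 5`): the
  cross monomial `X^{α+β}` of the square, although pointwise dominated by the two pure squares (AM–GM), DOES carry a Descartes alternation when the
  exponents are close — a square costs a root exactly when `β ≥ 2α`, not in general.
READING for the line (report HOME/DOOR-A34-P3G22-REPORT.md): located «phantom-monomial» ceilings (coefficients made of AM–GM-dominated cross terms «do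
not count») are NOT laws; the kernel statement is the one above, with its sharp boundary.

[folklore] Rolle's theorem in a Descartes system (twisted Rolle), elementary sign analysis, intermediate value theorem; no single source.
-/

-- `Summit.ValiantsHypothesis.ValiantsHypothesis.…` repeats a component by the D-0017 layout
-- (single-conjunct summit), which the `dupNamespace` linter flags; the name is mandated.
set_option linter.dupNamespace false

namespace Summit.ValiantsHypothesis.ValiantsHypothesis.Theorems.LacunarySymmetroidMatrixDescartes.Census.SquareLaw

open Polynomial Finset
open scoped BigOperators Polynomial

/-! ## 1. The hollow-cross determinants (any commutative ring) -/

/-- **Hollow-cross determinant**: `det [[a,0,q],[0,b,p],[q,p,0]] = −(a·p² + b·q²)` — the isotropic sector of the symmetric `3 × 3`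
format is the signed two-squares family. [folklore] -/
theorem det_hollowCross {R : Type*} [CommRing R] (a b p q : R) :
    (!![a, 0, q; 0, b, p; q, p, 0] : Matrix (Fin 3) (Fin 3) R).det = -(a * p ^ 2 + b * q ^ 2) := by
  simp [Matrix.det_fin_three]
  ring

/-- **Hollow cross with independent borders** (the shape of the Hermitian analogue, where `p'`, `q'` play the conjugates):
`det [[a,0,q],[0,b,p],[q',p',0]] = −(a·p·p' + b·q·q')`. [folklore] -/
theorem det_hollowCross' {R : Type*} [CommRing R] (a b p q p' q' : R) :
    (!![a, 0, q; 0, b, p; q', p', 0] : Matrix (Fin 3) (Fin 3) R).det = -(a * p * p' + b * q * q') := by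
  simp [Matrix.det_fin_three]
  ring

/-- **The unit hollow cross**: `det [[−1,0,1],[0,−M,L],[1,L,0]] = L² + M` — the square object `L² + M` IS a symmetric `3 × 3` determinant of
hollow-cross shape. [folklore] -/
theorem det_unitHollowCross {R : Type*} [CommRing R] (L M : R) :
    (!![-1, 0, 1; 0, -M, L; 1, L, 0] : Matrix (Fin 3) (Fin 3) R).det = L ^ 2 + M := by
  simp [Matrix.det_fin_three]
  ring

/-! ## 2. A twisted top form with outer coefficients of opposite (weak) signs has at most one positive root -/

/-- If `A ≤ 0 ≤ C` then `A·Xⁱ + B·X^{i+n} + C·X^{i+2n}` (`n ≥ 1`) has at most ONE distinct positive root.  (Two positive roots `x₁ ≠ x₂` give, with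
`yₖ = xₖⁿ`, `A + B yₖ + C yₖ² = 0`, whence `A = C·y₁y₂ ≥ 0`, so `A = C = B = 0` and the polynomial vanishes — but the zero polynomial has no
roots.) [folklore] -/
theorem card_posRoots_le_one_of_nonpos_nonneg (i n : ℕ) (hn : 0 < n) (A B Cc : ℝ) (hA : A ≤ 0) (hC : 0 ≤ Cc) :
    ((C A * X ^ i + C B * X ^ (i + n) + C Cc * X ^ (i + 2 * n)).roots.toFinset.filter (fun x => 0 < x)).card ≤ 1 := by
  by_contra h
  push Not at h
  obtain ⟨x₁, hx₁, x₂, hx₂, hne⟩ := Finset.one_lt_card.mp h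
  simp only [Finset.mem_filter, Multiset.mem_toFinset] at hx₁ hx₂
  obtain ⟨hr₁, hpos₁⟩ := hx₁
  obtain ⟨hr₂, hpos₂⟩ := hx₂
  have hp0 : C A * X ^ i + C B * X ^ (i + n) + C Cc * X ^ (i + 2 * n) ≠ 0 := fun h0 => by
    rw [h0, roots_zero] at hr₁; simp at hr₁
  have ev : ∀ x : ℝ, (C A * X ^ i + C B * X ^ (i + n) + C Cc * X ^ (i + 2 * n)).eval x
      = x ^ i * (A + B * x ^ n + Cc * (x ^ n) ^ 2) := by
    intro x
    simp only [eval_add, eval_mul, eval_C, eval_pow, eval_X]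
    ring
  have root_eq : ∀ x : ℝ, 0 < x → (C A * X ^ i + C B * X ^ (i + n) + C Cc * X ^ (i + 2 * n)).IsRoot x →
      A + B * x ^ n + Cc * (x ^ n) ^ 2 = 0 := by
    intro x hx hroot
    have h1 : x ^ i * (A + B * x ^ n + Cc * (x ^ n) ^ 2) = 0 := by rw [← ev]; exact hroot
    rcases mul_eq_zero.mp h1 with h2 | h2
    · exact absurd h2 (pow_ne_zero _ hx.ne')
    · exact h2
  have e₁ := root_eq x₁ hpos₁ ((mem_roots hp0).mp hr₁)
  have e₂ := root_eq x₂ hpos₂ ((mem_roots hp0).mp hr₂)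
  set y₁ := x₁ ^ n with hy₁
  set y₂ := x₂ ^ n with hy₂
  have hy₁pos : 0 < y₁ := pow_pos hpos₁ n
  have hy₂pos : 0 < y₂ := pow_pos hpos₂ n
  have hyne : y₁ ≠ y₂ := by
    intro hy
    apply hne
    exact (pow_left_inj₀ hpos₁.le hpos₂.le hn.ne').mp hy
  have key : (y₂ - y₁) * (A - Cc * y₁ * y₂) = 0 := by linear_combination y₂ * e₁ - y₁ * e₂
  have hA' : A = Cc * y₁ * y₂ := by
    have := mul_eq_zero.mp key
    rcases this with h1 | h1
    · exact absurd (sub_eq_zero.mp h1).symm hyne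
    · exact sub_eq_zero.mp h1
  have hprod : 0 ≤ Cc * y₁ * y₂ := by positivity
  have hA0 : A = 0 := le_antisymm hA (hA' ▸ hprod)
  have hC0 : Cc = 0 := by
    have h1 : Cc * y₁ * y₂ = 0 := by rw [← hA']; exact hA0
    rcases mul_eq_zero.mp h1 with h2 | h2
    · rcases mul_eq_zero.mp h2 with h3 | h3
      · exact h3
      · exact absurd h3 hy₁pos.ne'
    · exact absurd h2 hy₂pos.ne'
  have hB0 : B = 0 := by
    have h1 : B * y₁ = 0 := by
      have := e₁; rw [hA0, hC0] at this; linarith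
    rcases mul_eq_zero.mp h1 with h2 | h2
    · exact h2
    · exact absurd h2 hy₁pos.ne'
  apply hp0
  rw [hA0, hB0, hC0]
  simp

/-! ## 3. The SQUARE LAW: `L² + M` on a three-letter alphabet `1, X^α, X^β` with `β ≥ 2α` has at most four positive roots -/

/-- Expansion of the square object on the alphabet `(0, α, α+n)` as a six-term fewnomial on the exponents
`0, α, α+n, 2α, 2α+n, 2α+2n`. [folklore] -/
theorem sq_add_eq_sum (α n : ℕ) (w u v m₀ m₁ m₂ : ℝ) :
    (C w + C u * X ^ α + C v * X ^ (α + n)) ^ 2 + (C m₀ + C m₁ * X ^ α + C m₂ * X ^ (α + n))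
      = ∑ t : Fin 6, C ((![w ^ 2 + m₀, 2 * u * w + m₁, 2 * v * w + m₂, u ^ 2, 2 * u * v, v ^ 2] : Fin 6 → ℝ) t)
          * X ^ ((![0, α, α + n, 2 * α, 2 * α + n, 2 * α + 2 * n] : Fin 6 → ℕ) t) := by
  simp only [Fin.sum_univ_succ, Fin.sum_univ_zero, Matrix.cons_val_zero, Matrix.cons_val_succ,
    map_add, map_mul, map_pow, map_ofNat, pow_zero, mul_one, add_zero]
  ring

/-- **THE SQUARE LAW.**  On a three-letter alphabet `1, X^α, X^{α+n}` with `0 < α ≤ n` (i.e. `β = α + n ≥ 2α`), for all real `w u v m₀ m₁ m₂` the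
square object `(w + uX^α + vX^{α+n})² + (m₀ + m₁X^α + m₂X^{α+n})` — six monomials, Descartes bound five — has AT MOST FOUR distinct positive
roots.  Twisted Rolle kills the three alphabet exponents at the price of three roots; the surviving top form is
`X^{2α}·(2α²(2α−β)u² + αβ(α+β)·2uv·Xⁿ + 2β²(2β−α)v²·X^{2n})` with first coefficient `≤ 0` and last `≥ 0`, hence at most one positive root. [folklore] -/
theorem card_posRoots_sq_add_le_four (α n : ℕ) (hα : 0 < α) (hαn : α ≤ n) (w u v m₀ m₁ m₂ : ℝ) :
    (((C w + C u * X ^ α + C v * X ^ (α + n)) ^ 2 + (C m₀ + C m₁ * X ^ α + C m₂ * X ^ (α + n))).roots.toFinset.filter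
      (fun x => 0 < x)).card ≤ 4 := by
  rw [sq_add_eq_sum]
  set e : Fin 6 → ℕ := ![0, α, α + n, 2 * α, 2 * α + n, 2 * α + 2 * n] with he
  set c : Fin 6 → ℝ := ![w ^ 2 + m₀, 2 * u * w + m₁, 2 * v * w + m₂, u ^ 2, 2 * u * v, v ^ 2] with hc
  have step := Census.card_posRoots_le_card_posRoots_twists e c ({0, 1, 2} : Finset (Fin 6))
  have hU : ({0, 1, 2} : Finset (Fin 6)).card = 3 := by decide
  rw [hU] at step
  -- the twisted fewnomial is the top form `X^{2α}(A + B Xⁿ + C X^{2n})`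
  have hn0 : 0 < n := lt_of_lt_of_le hα hαn
  set A : ℝ := u ^ 2 * ((2 * α : ℝ) * α * ((2 * α : ℝ) - (α + n))) with hA
  set B : ℝ := 2 * u * v * (((2 * α + n : ℕ) : ℝ) * ((2 * α + n : ℕ) - α : ℝ) * (((2 * α + n : ℕ) : ℝ) - (α + n : ℕ))) with hB
  set Cc : ℝ := v ^ 2 * (((2 * α + 2 * n : ℕ) : ℝ) * ((2 * α + 2 * n : ℕ) - α : ℝ) * (((2 * α + 2 * n : ℕ) : ℝ) - (α + n : ℕ))) with hCc
  have htw : (∑ t : Fin 6, C (c t * ∏ u' ∈ ({0, 1, 2} : Finset (Fin 6)), ((e t : ℝ) - e u')) * X ^ (e t))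
      = C A * X ^ (2 * α) + C B * X ^ (2 * α + n) + C Cc * X ^ (2 * α + 2 * n) := by
    have hprod : ∀ t : Fin 6, ∏ u' ∈ ({0, 1, 2} : Finset (Fin 6)), ((e t : ℝ) - e u')
        = ((e t : ℝ) - e 0) * (((e t : ℝ) - e 1) * ((e t : ℝ) - e 2)) := by
      intro t
      rw [Finset.prod_insert (by decide), Finset.prod_insert (by decide), Finset.prod_singleton]
    simp only [hprod]
    simp only [Fin.sum_univ_succ, Fin.sum_univ_zero, he, hc, Matrix.cons_val_zero, Matrix.cons_val_succ,
      Matrix.cons_val_one]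
    simp only [hA, hB, hCc]
    push_cast
    simp only [sub_self, mul_zero, zero_mul, map_zero, zero_add, add_zero]
    ring
  rw [htw] at step
  have hAle : A ≤ 0 := by
    rw [hA]
    have h1 : (2 * α : ℝ) - (α + n) ≤ 0 := by
      have : (α : ℝ) ≤ n := by exact_mod_cast hαn
      linarith
    have h2 : 0 ≤ u ^ 2 * ((2 * α : ℝ) * α) := by positivity
    nlinarith
  have hCge : 0 ≤ Cc := by
    rw [hCc]
    have hα0 : (0 : ℝ) ≤ α := by positivity
    have hn0' : (0 : ℝ) ≤ n := by positivity
    have h1 : (0 : ℝ) ≤ ((2 * α + 2 * n : ℕ) : ℝ) - α := by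
      push_cast
      linarith
    have h2 : (0 : ℝ) ≤ ((2 * α + 2 * n : ℕ) : ℝ) - (α + n : ℕ) := by
      push_cast
      linarith
    positivity
  have top := card_posRoots_le_one_of_nonpos_nonneg (2 * α) n hn0 A B Cc hAle hCge
  have e3 : 2 * α + 2 * n = 2 * α + 2 * n := rfl
  omega

/-! ## 4. Sharp failure when `α < β < 2α`: a five-root member on the alphabet `(0, 2, 3)` -/

/-- **FIVE positive roots on `(0,2,3)`** (so the Square Law's hypothesis `β ≥ 2α` cannot be dropped): the square object
`(2000X² − 653X³)² + (−5232 + 418400X² − 2174000X³)` takes the signs `−,+,−,+,−,+` at `1/5 < 27/100 < 9/25 < 1/2 < 2 < 5`, hence has at least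
(and, having six monomials, exactly) five distinct positive roots. [folklore] -/
theorem five_le_card_posRoots_squareWitness :
    5 ≤ (((C (0 : ℝ) + C 2000 * X ^ 2 + C (-653) * X ^ (2 + 1)) ^ 2
        + (C (-5232) + C 418400 * X ^ 2 + C (-2174000) * X ^ (2 + 1))).roots.toFinset.filter (fun x => 0 < x)).card := by
  refine SymmetroidDescartes.le_card_posRoots_of_alternating _ 5 ![1/5, 27/100, 9/25, 1/2, 2, 5] ?_ ?_ ?_
  · refine Fin.strictMono_iff_lt_succ.mpr ?_
    intro j
    fin_cases j <;> simp <;> norm_num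
  · intro j
    fin_cases j <;> simp
  · intro j
    fin_cases j <;> simp <;> norm_num

/-! ## 5. The same law in pencil currency: a six-parameter sector of the symmetric `3 × 3` three-letter format -/

/-- The three symmetric letters of the UNIT HOLLOW-CROSS pencil on the alphabet `(0, α, α+n)`: the pencil matrix is
`[[−1, 0, 1], [0, −M, L], [1, L, 0]]` with `L = w + uX^α + vX^{α+n}`, `M = m₀ + m₁X^α + m₂X^{α+n}`. [folklore] -/
theorem unitHollowCross_pencil_eq (α n : ℕ) (w u v m₀ m₁ m₂ : ℝ) :
    (∑ l : Fin 3, (X : ℝ[X]) ^ ((![0, α, α + n] : Fin 3 → ℕ) l) •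
        ((![!![-1, 0, 1; 0, -m₀, w; 1, w, 0], !![0, 0, 0; 0, -m₁, u; 0, u, 0], !![0, 0, 0; 0, -m₂, v; 0, v, 0]] :
          Fin 3 → Matrix (Fin 3) (Fin 3) ℝ) l).map C)
      = !![-1, 0, 1; 0, -(C m₀ + C m₁ * X ^ α + C m₂ * X ^ (α + n)), C w + C u * X ^ α + C v * X ^ (α + n);
          1, C w + C u * X ^ α + C v * X ^ (α + n), 0] := by
  refine Matrix.ext fun i j => ?_
  fin_cases i <;> fin_cases j <;>
    simp [Matrix.sum_apply, Fin.sum_univ_three, Matrix.smul_apply, Matrix.map_apply]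
  ring

/-- **SQUARE LAW, pencil form.**  The real symmetric three-letter `3 × 3` pencil with letters
`S₀ = [[−1,0,1],[0,−m₀,w],[1,w,0]]`, `S₁ = [[0,0,0],[0,−m₁,u],[0,u,0]]`, `S₂ = [[0,0,0],[0,−m₂,v],[0,v,0]]` on the exponents `(0, α, α+n)`,
`0 < α ≤ n`, has at most FOUR distinct positive roots of its determinant (its determinant is the square object `L² + M`; six monomials,
Descartes bound five).  A six-parameter sector of the `(3,3)` format — whose full symmetric census value is `9` — with a PROVED deficiency;
for `α < β < 2α` the same sector is Descartes-sharp (`five_le_card_posRoots_squareWitness`). [folklore] -/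
theorem card_posRoots_unitHollowCross_pencil_le_four (α n : ℕ) (hα : 0 < α) (hαn : α ≤ n) (w u v m₀ m₁ m₂ : ℝ) :
    ((Matrix.det (∑ l : Fin 3, (X : ℝ[X]) ^ ((![0, α, α + n] : Fin 3 → ℕ) l) •
        ((![!![-1, 0, 1; 0, -m₀, w; 1, w, 0], !![0, 0, 0; 0, -m₁, u; 0, u, 0], !![0, 0, 0; 0, -m₂, v; 0, v, 0]] :
          Fin 3 → Matrix (Fin 3) (Fin 3) ℝ) l).map C)).roots.toFinset.filter (fun x => 0 < x)).card ≤ 4 := by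
  rw [unitHollowCross_pencil_eq, det_unitHollowCross]
  exact card_posRoots_sq_add_le_four α n hα hαn w u v m₀ m₁ m₂

end Summit.ValiantsHypothesis.ValiantsHypothesis.Theorems.LacunarySymmetroidMatrixDescartes.Census.SquareLaw
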